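import Literature.MathematicalPhysics.KineticTheory.HarmonicChaosDecomposition
import HarnessLib

/-!
# Stub K2 `stub_wickShellStatic`, part I: shell combinatorics and transports
(line `gram-pencil-harmonic-chaos`, crux `EmbeddedDrudeMourre.DrudeDissolution`,
item stmt-AtomisticToContinuum-12593; `--supports` file, closes nothing; lead c11)

WHAT. Purely structural lemmas about the zero-momentum shells `Shell m n` of the harmonic chaos space
(`HarmonicChaosDecomposition.lean`) used by the static shell formula (stub K2):
* `exists_sum_equiv_of_card`: a subset `S ⊆ Fin N` of size `m` (complement of size `n`) is the image of the
  left summand under a bijection `Fin m ⊕ Fin n ≃ Fin N`;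
* `exists_shellTransport`: for such a bijection, the map `k ↦ ((−k ∘ e ∘ inl), (k ∘ e ∘ inr))` is a
  measure-preserving map from the "big shell" `Shell N 0 = {Σ k = 0}` onto `Shell m n` (a continuous additive
  equivalence of compact groups, `HarmonicChaos.measurePreserving_addEquiv`);
* `exists_bigShell_two/four`: measure-preserving parametrisations `𝕋 → Shell 2 0`, `𝕋3 → Shell 4 0`;
* `sum_perm_slotKernel_eq`: summing the pattern kernel of a Wick monomial over all relabellings of its slots
  gives `√(m! n!)` times the tree's symmetrised `wickKernel`.
-/

noncomputable section

namespace Summit.AtomisticToContinuum.FouriersLaw.Theorems.DrudeDissolution.GramPencilHarmonicChaos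

open MeasureTheory Filter Set Function Topology
open scoped InnerProductSpace ENNReal ComplexConjugate
open Literature.MathematicalPhysics.KineticTheory
open Literature.MathematicalPhysics.KineticTheory.HeatConduction
open HarmonicChaos ProbabilityTheory
open PinnedChainKinetic (𝕋 𝕋3 μ𝕋 μ𝕋3)
open scoped Literature.MathematicalPhysics.KineticTheory.HeatConduction.PinnedChainKinetic

/-! ## Subsets as left summands -/

/-- A subset `S` of `Fin N` with `|S| = m`, `|Sᶜ| = n` is the image of `Fin m` under a bijection
`Fin m ⊕ Fin n ≃ Fin N` whose right summand covers the complement. [folklore] -/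
theorem exists_sum_equiv_of_card {N m n : ℕ} (S : Finset (Fin N)) (hm : S.card = m)
    (hn : Sᶜ.card = n) :
    ∃ e : Fin m ⊕ Fin n ≃ Fin N, (∀ i, e (Sum.inl i) ∈ S) ∧ (∀ j, e (Sum.inr j) ∉ S) := by
  classical
  let eS : Fin m ≃ {x // x ∈ S} := (S.orderIsoOfFin hm).toEquiv
  let eC : Fin n ≃ {x // x ∉ S} :=
    (Sᶜ.orderIsoOfFin hn).toEquiv.trans (Equiv.subtypeEquivRight (fun x => by simp [Finset.mem_compl]))
  refine ⟨(Equiv.sumCongr eS eC).trans (Equiv.sumCompl (· ∈ S)), fun i => ?_, fun j => ?_⟩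
  · simp only [Equiv.trans_apply, Equiv.sumCongr_apply, Sum.map_inl, Equiv.sumCompl_apply_inl]
    exact (eS i).2
  · simp only [Equiv.trans_apply, Equiv.sumCongr_apply, Sum.map_inr, Equiv.sumCompl_apply_inr]
    exact (eC j).2

/-! ## Transport between shells -/

/-- **Pattern transport.** For a bijection `e : Fin m ⊕ Fin n ≃ Fin N` there is a measure-preserving map
from the big shell `Shell N 0 = {k : Σ_i k_i = 0}` to `Shell m n` sending `k` to the configuration with
created momenta `−k_{e(inl i)}` and annihilated momenta `k_{e(inr j)}` (a continuous additive isomorphism of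
compact groups; Haar probability measures correspond). [folklore] -/
theorem exists_shellTransport {N m n : ℕ} (e : Fin m ⊕ Fin n ≃ Fin N) :
    ∃ Φ : Shell N 0 → Shell m n, MeasurePreserving Φ (shellMeasure N 0) (shellMeasure m n) ∧
      ∀ κ : Shell N 0,
        (∀ i : Fin m, ((Φ κ : Shell m n) : SectorConfig m n).1 i = -((κ : SectorConfig N 0).1 (e (Sum.inl i)))) ∧
        (∀ j : Fin n, ((Φ κ : Shell m n) : SectorConfig m n).2 j = (κ : SectorConfig N 0).1 (e (Sum.inr j))) := by
  classical
  -- the additive equivalence of configurations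
  let E : SectorConfig N 0 ≃+ SectorConfig m n :=
    { toFun := fun κ => (fun i => -(κ.1 (e (Sum.inl i))), fun j => κ.1 (e (Sum.inr j)))
      invFun := fun κ' => (fun x => Sum.elim (fun i => -(κ'.1 i)) (fun j => κ'.2 j) (e.symm x), Fin.elim0)
      left_inv := by
        intro κ
        ext x
        · simp only
          rcases hx : e.symm x with i | j
          · simp only [Sum.elim_inl]
            rw [← hx, Equiv.apply_symm_apply, neg_neg]
          · simp only [Sum.elim_inr]
            rw [← hx, Equiv.apply_symm_apply]
        · exact Fin.elim0 x
      right_inv := by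
        intro κ'
        ext i
        · simp only [Equiv.symm_apply_apply, Sum.elim_inl, neg_neg]
        · simp only [Equiv.symm_apply_apply, Sum.elim_inr]
      map_add' := by
        intro κ κ'
        ext i
        · simp only [Prod.fst_add, Pi.add_apply, neg_add]
        · simp only [Prod.fst_add, Pi.add_apply, Prod.snd_add] }
  have hE : ∀ κ : SectorConfig N 0, E κ = ((fun i => -(κ.1 (e (Sum.inl i)))), fun j => κ.1 (e (Sum.inr j))) :=
    fun κ => rfl
  -- shells correspond
  have hsum : ∀ κ : SectorConfig N 0,
      ∑ i, (E κ).1 i - ∑ j, (E κ).2 j = -(∑ x, κ.1 x) := by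
    intro κ
    rw [hE]
    simp only [Finset.sum_neg_distrib]
    rw [← Fintype.sum_equiv e (fun y => κ.1 (e y)) (fun x => κ.1 x) (fun _ => rfl), Fintype.sum_sum_type]
    abel
  have h₁ : ∀ κ ∈ shell N 0, E κ ∈ shell m n := by
    intro κ hκ
    rw [mem_shell_iff] at hκ ⊢
    rw [hsum]
    simp only [Finset.univ_eq_empty, Finset.sum_empty, sub_zero] at hκ
    rw [hκ, neg_zero]
  have h₂ : ∀ κ' ∈ shell m n, E.symm κ' ∈ shell N 0 := by
    intro κ' hκ'
    have h := hsum (E.symm κ')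
    rw [E.apply_symm_apply] at h
    rw [mem_shell_iff] at hκ' ⊢
    simp only [Finset.univ_eq_empty, Finset.sum_empty, sub_zero]
    rw [hκ'] at h
    exact neg_eq_zero.1 h.symm
  let Φ := restrictShell E h₁ h₂
  have hc : Continuous E := by
    refine Continuous.prodMk ?_ ?_
    · exact continuous_pi fun i => ((continuous_apply _).comp continuous_fst).neg
    · exact continuous_pi fun j => (continuous_apply _).comp continuous_fst
  have hcs : Continuous E.symm := by
    refine Continuous.prodMk ?_ continuous_const
    refine continuous_pi fun x => ?_
    show Continuous fun κ' : SectorConfig m n => Sum.elim (fun i => -(κ'.1 i)) (fun j => κ'.2 j) (e.symm x)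
    rcases e.symm x with i | j
    · simp only [Sum.elim_inl]
      exact ((continuous_apply i).comp continuous_fst).neg
    · simp only [Sum.elim_inr]
      exact (continuous_apply j).comp continuous_snd
  refine ⟨Φ, ?_, fun κ => ⟨fun i => rfl, fun j => rfl⟩⟩
  exact measurePreserving_addEquiv (shellMeasure N 0) (shellMeasure m n) Φ
    (continuous_restrictShell E h₁ h₂ hc) (continuous_restrictShell_symm E h₁ h₂ hcs)

/-! ## Parametrisations of the big shells by tori -/

/-- **The big shell of degree `2` is a circle**: `k ↦ (k, −k)` is a measure-preserving map
`(𝕋, μ𝕋) → (Shell 2 0, σ)`. [folklore] -/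
theorem exists_bigShell_two :
    ∃ Φ : 𝕋 → Shell 2 0, MeasurePreserving Φ μ𝕋 (shellMeasure 2 0) ∧
      ∀ k : 𝕋, ((Φ k : Shell 2 0) : SectorConfig 2 0).1 = ![k, -k] := by
  have hmem : ∀ k : 𝕋, ((![k, -k], Fin.elim0) : SectorConfig 2 0) ∈ shell 2 0 := by
    intro k
    rw [mem_shell_iff]
    simp [Fin.sum_univ_two]
  let E : 𝕋 ≃+ Shell 2 0 :=
    { toFun := fun k => ⟨(![k, -k], Fin.elim0), hmem k⟩
      invFun := fun s => (s : SectorConfig 2 0).1 0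
      left_inv := fun k => by simp
      right_inv := by
        intro s
        have hs := (mem_shell_iff (s : SectorConfig 2 0)).1 s.2
        simp only [Finset.univ_eq_empty, Finset.sum_empty, sub_zero, Fin.sum_univ_two] at hs
        apply Subtype.ext
        ext i
        · fin_cases i
          · rfl
          · show -((s : SectorConfig 2 0).1 0) = (s : SectorConfig 2 0).1 1
            exact (neg_eq_of_add_eq_zero_right hs)
        · exact Fin.elim0 i
      map_add' := by
        intro k k'
        apply Subtype.ext
        ext i
        · fin_cases i
          · rfl
          · show -(k + k') = -k + -k'
            exact neg_add k k'
        · exact Fin.elim0 i }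
  have hc : Continuous E := by
    refine Continuous.subtype_mk (Continuous.prodMk ?_ continuous_const) _
    refine continuous_pi fun i => ?_
    fin_cases i
    · exact continuous_id
    · exact continuous_neg
  have hcs : Continuous E.symm :=
    (continuous_apply (0 : Fin 2)).comp (continuous_fst.comp continuous_subtype_val)
  exact ⟨E, measurePreserving_addEquiv μ𝕋 (shellMeasure 2 0) E hc hcs, fun k => rfl⟩

/-- **The big shell of degree `4` is a `3`-torus**: `(k₁,k₂,k₃) ↦ (k₁, k₂, k₃, −(k₁+k₂+k₃))` is a
measure-preserving map `(𝕋3, μ𝕋3) → (Shell 4 0, σ)`. [folklore] -/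
theorem exists_bigShell_four :
    ∃ Φ : 𝕋3 → Shell 4 0, MeasurePreserving Φ μ𝕋3 (shellMeasure 4 0) ∧
      ∀ κ : 𝕋3, ((Φ κ : Shell 4 0) : SectorConfig 4 0).1 = ![κ.1, κ.2.1, κ.2.2, -(κ.1 + κ.2.1 + κ.2.2)] := by
  have hmem : ∀ κ : 𝕋3,
      ((![κ.1, κ.2.1, κ.2.2, -(κ.1 + κ.2.1 + κ.2.2)], Fin.elim0) : SectorConfig 4 0) ∈ shell 4 0 := by
    intro κ
    rw [mem_shell_iff]
    simp [Fin.sum_univ_four]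
  let E : 𝕋3 ≃+ Shell 4 0 :=
    { toFun := fun κ => ⟨(![κ.1, κ.2.1, κ.2.2, -(κ.1 + κ.2.1 + κ.2.2)], Fin.elim0), hmem κ⟩
      invFun := fun s => ((s : SectorConfig 4 0).1 0, (s : SectorConfig 4 0).1 1, (s : SectorConfig 4 0).1 2)
      left_inv := fun κ => by simp
      right_inv := by
        intro s
        have hs := (mem_shell_iff (s : SectorConfig 4 0)).1 s.2
        simp only [Finset.univ_eq_empty, Finset.sum_empty, sub_zero, Fin.sum_univ_four] at hs
        apply Subtype.ext
        ext i
        · fin_cases i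
          · rfl
          · rfl
          · rfl
          · show -((s : SectorConfig 4 0).1 0 + (s : SectorConfig 4 0).1 1 + (s : SectorConfig 4 0).1 2) =
              (s : SectorConfig 4 0).1 3
            exact (neg_eq_of_add_eq_zero_right hs)
        · exact Fin.elim0 i
      map_add' := by
        intro κ κ'
        apply Subtype.ext
        ext i
        · fin_cases i
          · rfl
          · rfl
          · rfl
          · show -((κ.1 + κ'.1) + (κ.2.1 + κ'.2.1) + (κ.2.2 + κ'.2.2)) =
              -(κ.1 + κ.2.1 + κ.2.2) + -(κ'.1 + κ'.2.1 + κ'.2.2)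
            abel
        · exact Fin.elim0 i }
  have hc : Continuous E := by
    refine Continuous.subtype_mk (Continuous.prodMk ?_ continuous_const) _
    refine continuous_pi fun i => ?_
    fin_cases i
    · exact continuous_fst
    · exact continuous_fst.comp continuous_snd
    · exact continuous_snd.comp continuous_snd
    · exact ((continuous_fst.add (continuous_fst.comp continuous_snd)).add
        (continuous_snd.comp continuous_snd)).neg
  have hcs : Continuous E.symm := by
    refine Continuous.prodMk ?_ (Continuous.prodMk ?_ ?_)
    · exact (continuous_apply (0 : Fin 4)).comp (continuous_fst.comp continuous_subtype_val)
    · exact (continuous_apply (1 : Fin 4)).comp (continuous_fst.comp continuous_subtype_val)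
    · exact (continuous_apply (2 : Fin 4)).comp (continuous_fst.comp continuous_subtype_val)
  haveI h1 : (μ𝕋.prod μ𝕋).IsAddHaarMeasure := inferInstance
  haveI h2 : SFinite (μ𝕋.prod μ𝕋) := inferInstance
  haveI h3 : MeasurableAdd (𝕋 × 𝕋) := inferInstance
  haveI h4 : (μ𝕋3).IsAddHaarMeasure := Measure.prod.instIsAddHaarMeasure μ𝕋 (μ𝕋.prod μ𝕋)
  exact ⟨E, measurePreserving_addEquiv μ𝕋3 (shellMeasure 4 0) E hc hcs, fun κ => rfl⟩

/-! ## Symmetrisation over slot relabellings -/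

/-- **Slot symmetrisation.** For a bijection `e : Fin m ⊕ Fin n ≃ Fin N` (which slots are created, which
annihilated) and a Wick monomial `h : Fin N → TestFn`, summing the pattern kernel
`Π_i conj(w_{h(ρ(e(inl i)))}(k_i)) · Π_j w_{h(ρ(e(inr j)))}(k'_j)` over ALL relabellings `ρ ∈ S_N` of the slots
gives `√(m! n!) · wickKernel h m n` (the tree's flat-normalised symmetric kernel sums over all bijections
`Fin m ⊕ Fin n ≃ Fin N`, and `ρ ↦ e ∘ ρ` is a bijection onto those). [cite: Janson1997, Thm 3.9] -/
theorem sum_perm_slotKernel_eq (ω₂ T : ℝ) {N m n : ℕ} (e : Fin m ⊕ Fin n ≃ Fin N) (h : Fin N → TestFn)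
    (κ : Shell m n) :
    ∑ ρ : Equiv.Perm (Fin N),
        (∏ i : Fin m, conj (thermalWave ω₂ T (h (ρ (e (Sum.inl i)))) ((κ : SectorConfig m n).1 i))) *
          ∏ j : Fin n, thermalWave ω₂ T (h (ρ (e (Sum.inr j)))) ((κ : SectorConfig m n).2 j) =
      ((Real.sqrt (m.factorial * n.factorial) : ℝ) : ℂ) * wickKernel ω₂ T h m n κ := by
  have hpos : (0 : ℝ) < Real.sqrt (m.factorial * n.factorial) := by
    apply Real.sqrt_pos.2
    exact_mod_cast Nat.mul_pos (Nat.factorial_pos m) (Nat.factorial_pos n)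
  have hne : ((Real.sqrt (m.factorial * n.factorial) : ℝ) : ℂ) ≠ 0 :=
    Complex.ofReal_ne_zero.2 hpos.ne'
  unfold wickKernel
  rw [← mul_assoc, mul_inv_cancel₀ hne, one_mul]
  -- reindex the sum over relabellings along `ρ ↦ e.trans ρ`
  let Ψ : Equiv.Perm (Fin N) ≃ (Fin m ⊕ Fin n ≃ Fin N) :=
    { toFun := fun ρ => e.trans ρ
      invFun := fun β => e.symm.trans β
      left_inv := fun ρ => by ext x; simp
      right_inv := fun β => by ext x; simp }
  refine Fintype.sum_equiv Ψ _ _ (fun ρ => ?_)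
  rfl

end Summit.AtomisticToContinuum.FouriersLaw.Theorems.DrudeDissolution.GramPencilHarmonicChaos

end
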